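import Literature.Barriers.QuantumFields.ScalarPhi4Triviality
import Literature.MathematicalPhysics.QuantumFieldTheory.ContinuumLimitsPhi4GaussianDomination
import HarnessLib

/-!
# The barrier `ScalarPhi4Triviality` reduced to Aizenman–Duminil-Copin's Prop. 7.2

Proofs-only companion of `Literature/Barriers/QuantumFields/ScalarPhi4Triviality.lean` (the barrier
`ScalarPhi4Triviality` is, by construction, the tree fact
`Literature.MathematicalPhysics.QuantumFieldTheory.phi44_triviality`, `scalarPhi4Triviality_iff`).
No statement of that file is changed; no definition and no named fact is introduced. It complements
the sibling `ScalarPhi4TrivialityProofs.lean` (`scalarPhi4Triviality_of_prop72`: the barrier from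
Prop. 7.2 and the two-sided p. 6 variance bounds stated verbatim for the printed infinite-volume state,
`HasBoxLimit (phi4BoxExpect …)`, `phi4NormalizedField`, through `phi44_triviality_of_prop72`) with the
LAW-LEVEL reduction: hypotheses directly on the thermodynamic-limit laws `ν_δ` of the restated fact, and
fewer of them — no existence of infinite-volume exponential moments, no exponential integrability and
no separate upper variance bound are asked, these being supplied by the `φ⁴` line
`GriffithsSimonApproximation` → `Phi4NewmanGaussianInequality` → `Phi4BoxGaussianBounds` →
`ContinuumLimitsPhi4GaussianDomination` (Aizenman–Duminil-Copin 2021, §2 and §7: block-Ising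
approximation of the lattice `φ⁴` measures, transfer of Newman's Gaussian domination, exponential
integrability and variance control of the thermodynamic-limit laws): `ScalarPhi4Triviality` follows
from the printed quantitative input of Thm 1.2 alone — for the thermodynamic-limit laws `ν_δ` of the
restated `phi44_triviality` inside its window, a scale `s(δ) ≥ 0`, the lower variance bound for one
compactly supported test function (p. 6) and the exponential-moment deviation estimate of Prop. 7.2
(p. 28) — through `phi44_triviality_of_mgfDeviation`.

## Sources

* M. Aizenman, H. Duminil-Copin, Ann. Math. 194 (2021) 163–235, arXiv:1912.07973: Thm 1.2 (p. 4),
  Prop. 7.2 (p. 28), p. 6 (display after Prop. 1.4), §6.3 (p. 26). [AizenmanDuminilCopinAnnals2021]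
-/

noncomputable section

open scoped SchwartzMap
open MeasureTheory Filter Topology
open Literature.MathematicalPhysics.QuantumLattice
open Literature.MathematicalPhysics.QuantumFieldTheory
open Literature.Probability.LatticeModels (box invCorrLength)

namespace Literature.Barriers.QuantumFields

/-- **`ScalarPhi4Triviality` from ADC Prop. 7.2.** The barrier (marginal triviality of `φ⁴₄` in the
sense of the tree's `phi44_triviality`) holds as soon as, for every family of thermodynamic-limit laws
`ν_δ` of the free-boundary lattice `φ⁴` box measures on `ℤ⁴` inside the window of the restated fact,
one has a scale `s(δ) ≥ 0` with a lower variance bound `c s(δ) ≤ ∫ ω(f₀)² dν_δ` for one compactly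
supported `f₀`, and for every compactly supported `f` the exponential-moment deviation estimate
`|∫ e^{wω(f)} dν_δ − e^{w² v_δ(f)/2}| ≤ K(δ) G(s(δ) w²)`, `K → 0`, `G` monotone — Aizenman–Duminil-Copin's
Prop. 7.2 (p. 28) with the variance bounds of p. 6, transcribed to the laws `ν_δ`. Every other
ingredient of the printed deduction "Prop. 7.2 ⇒ Thm 1.2" (p. 6) is proved in the tree
(`phi44_triviality_of_mgfDeviation`, `phi44_triviality_of_scaleBound`).
[cite: AizenmanDuminilCopinAnnals2021, Thm 1.2 (p. 4) via Prop. 7.2 (p. 28) and p. 6] -/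
theorem scalarPhi4Triviality_of_mgfDeviation
    (h : ∀ (g κ : ℝ), 0 < g → ∀ (J : ℝ → ℝ) (ρ : ℝ → ℝ)
      (ν : ℝ → Measure (FieldConfig (EuclideanSpace ℝ (Fin 4)))),
      (∀ δ, 0 < δ → 0 ≤ J δ ∧ J δ ≤ phi4CriticalJ 4 g κ) →
      (∃ M : ℝ, ∀ᶠ δ in 𝓝[>] (0 : ℝ), J δ = phi4CriticalJ 4 g κ ∨
          (0 < J δ ∧ invCorrLength (phi4TwoPoint 4 g κ (J δ)) ≤ M * δ)) →
      (∀ δ, 0 < δ → TendstoInLaw (fun R : ℕ =>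
          latticeFieldLaw (phi4BoxMeasure 4 R g κ (J δ)) (box 4 R) δ (ρ δ)) atTop (ν δ)) →
      ∃ s : ℝ → ℝ, (∀ᶠ δ in 𝓝[>] (0 : ℝ), 0 ≤ s δ) ∧
        (∃ (f₀ : 𝓢(EuclideanSpace ℝ (Fin 4), ℝ)) (c : ℝ), HasCompactSupport f₀ ∧ 0 < c ∧
          ∀ᶠ δ in 𝓝[>] (0 : ℝ), c * s δ ≤ ∫ ω, (ω f₀) ^ 2 ∂ν δ) ∧
        ∀ f : 𝓢(EuclideanSpace ℝ (Fin 4), ℝ), HasCompactSupport f →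
          ∃ (K : ℝ → ℝ) (G : ℝ → ℝ), Tendsto K (𝓝[>] 0) (𝓝 0) ∧ MonotoneOn G (Set.Ici 0) ∧
            ∀ᶠ δ in 𝓝[>] (0 : ℝ), ∀ w : ℝ,
              |(∫ ω, Real.exp (w * ω f) ∂ν δ) -
                  Real.exp (w ^ 2 * (∫ ω, (ω f) ^ 2 ∂ν δ) / 2)| ≤ K δ * G (s δ * w ^ 2)) :
    ScalarPhi4Triviality :=
  scalarPhi4Triviality_iff.mpr (phi44_triviality_of_mgfDeviation h)

/-- **The same with the variance of one reference observable as the scale.** Taking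
`s(δ) = ∫ ω(f₀)² dν_δ` for a fixed compactly supported `f₀` (the lower variance bound of
`scalarPhi4Triviality_of_mgfDeviation` is then an equality with `c = 1`, and `s ≥ 0` automatically):
`ScalarPhi4Triviality` holds as soon as, for the thermodynamic-limit laws `ν_δ` inside the window, there
is a compactly supported `f₀` such that every compactly supported `f` obeys the exponential-moment
deviation estimate `|∫ e^{wω(f)} dν_δ − e^{w² v_δ(f)/2}| ≤ K(δ) G(w² ∫ ω(f₀)² dν_δ)` with `K → 0`, `G`
monotone — Aizenman–Duminil-Copin's Prop. 7.2 with `z² = Σ_L (ρδ⁴)² w²` and the two-sided bounds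
`c_{f₀} ≤ ⟨T_{f₀,L}²⟩ ≤ C_{f₀}` of p. 6 absorbed into `G`. [cite: AizenmanDuminilCopinAnnals2021, Prop. 7.2 (p. 28) with p. 6 (display after Prop. 1.4)] -/
theorem scalarPhi4Triviality_of_mgfDeviation_varianceScale
    (h : ∀ (g κ : ℝ), 0 < g → ∀ (J : ℝ → ℝ) (ρ : ℝ → ℝ)
      (ν : ℝ → Measure (FieldConfig (EuclideanSpace ℝ (Fin 4)))),
      (∀ δ, 0 < δ → 0 ≤ J δ ∧ J δ ≤ phi4CriticalJ 4 g κ) →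
      (∃ M : ℝ, ∀ᶠ δ in 𝓝[>] (0 : ℝ), J δ = phi4CriticalJ 4 g κ ∨
          (0 < J δ ∧ invCorrLength (phi4TwoPoint 4 g κ (J δ)) ≤ M * δ)) →
      (∀ δ, 0 < δ → TendstoInLaw (fun R : ℕ =>
          latticeFieldLaw (phi4BoxMeasure 4 R g κ (J δ)) (box 4 R) δ (ρ δ)) atTop (ν δ)) →
      ∃ f₀ : 𝓢(EuclideanSpace ℝ (Fin 4), ℝ), HasCompactSupport f₀ ∧
        ∀ f : 𝓢(EuclideanSpace ℝ (Fin 4), ℝ), HasCompactSupport f →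
          ∃ (K : ℝ → ℝ) (G : ℝ → ℝ), Tendsto K (𝓝[>] 0) (𝓝 0) ∧ MonotoneOn G (Set.Ici 0) ∧
            ∀ᶠ δ in 𝓝[>] (0 : ℝ), ∀ w : ℝ,
              |(∫ ω, Real.exp (w * ω f) ∂ν δ) -
                  Real.exp (w ^ 2 * (∫ ω, (ω f) ^ 2 ∂ν δ) / 2)| ≤
                K δ * G ((∫ ω, (ω f₀) ^ 2 ∂ν δ) * w ^ 2)) :
    ScalarPhi4Triviality := by
  refine scalarPhi4Triviality_of_mgfDeviation fun g κ hg J ρ ν hJ hM hν => ?_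
  obtain ⟨f₀, hf₀, hf⟩ := h g κ hg J ρ ν hJ hM hν
  refine ⟨fun δ => ∫ ω, (ω f₀) ^ 2 ∂ν δ, Eventually.of_forall fun δ => integral_nonneg fun _ =>
    sq_nonneg _, ⟨f₀, 1, hf₀, one_pos, Eventually.of_forall fun δ => by rw [one_mul]⟩, hf⟩

end Literature.Barriers.QuantumFields

end
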